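import Literature.MathematicalPhysics.QuantumLattice.WilsonBlockHeatBathMarkov
import HarnessLib

/-!
# The overlapping block heat-bath sampler of the torus Wilson theory: triviality of `⋂_z 𝓕_{B_zᶜ}`

Theorems only.  The torus Wilson state `μ = wilsonMeasure ρ β` is equivalent to the product Haar measure
`π = Haar^{⊗ links}` (`wilsonMeasure_absolutelyContinuous_pi`: `μ = π.tilted (−β S_W)` with a bounded density, tree
`wilsonMeasure_eq_tilted_pi`), so statements about `μ`-a.e. versions of link-measurable functions are statements about
the PRODUCT measure, for which the link σ-algebras are independent:

* `exists_dependsOn_inter_of_ae_eq_pi` — under a product probability measure, a function a.e. equal both to a function of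
  the coordinates in `S` and to a function of the coordinates in `T` is a.e. equal to a function of the coordinates in
  `S ∩ T` (freeze the coordinates of `S ∖ T` at a Fubini-good value);
* `aestronglyMeasurable_linkSigma_inter` — hence `𝓕_S ∩ 𝓕_T = 𝓕_{S ∩ T}` modulo `μ`-null sets for the Wilson state;
* `ae_eq_const_of_forall_aestronglyMeasurable_extSigma` — a function which is `μ`-a.e. `𝓕_{B_zᶜ}`-measurable for EVERY
  block `z` is `μ`-a.e. constant (the blocks cover the torus): the kernel of the block heat-bath generator
  `∑_z (1 − E[· | 𝓕_{B_zᶜ}])` consists of the constants (Martinelli 1999 §3, ergodicity of block dynamics in finite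
  volume).

References: F. Martinelli, LNM 1717 (1999), §3; H.-O. Georgii, *Gibbs Measures and Phase Transitions* (2011), §1.2.
-/

noncomputable section

open MeasureTheory
open Literature.MathematicalPhysics.QuantumFieldTheory

namespace Literature.MathematicalPhysics.QuantumLattice.WilsonBlockHeatBath

/-! ### A Fubini lemma for product measures -/

section Product

/-- **Freezing unread coordinates.** Under a product probability measure `ν^{⊗ι}` (finite `ι`), if a measurable `g`
reading only the coordinates in `S` is a.e. equal to a measurable `h` reading only the coordinates in `T`, then `g` is
a.e. equal to a measurable function reading only the coordinates in `S ∩ T` — namely `g` with the coordinates of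
`S ∖ T` frozen at a value `v₀` for which `g(v₀, ·) = h(v₀, ·)` a.e. (Fubini). [folklore] -/
theorem exists_dependsOn_inter_of_ae_eq_pi {ι : Type*} [Fintype ι] {X : Type*} [MeasurableSpace X]
    (ν : Measure X) [IsProbabilityMeasure ν] {S T : Set ι} {g h : (ι → X) → ℝ} (hgm : Measurable g)
    (hhm : Measurable h) (hg : DependsOn g S) (hh : DependsOn h T)
    (hae : g =ᵐ[Measure.pi fun _ : ι => ν] h) :
    ∃ k : (ι → X) → ℝ, Measurable k ∧ DependsOn k (S ∩ T) ∧ k =ᵐ[Measure.pi fun _ : ι => ν] g := by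
  classical
  set p : ι → Prop := fun i => i ∈ S ∧ i ∉ T with hp
  set e := MeasurableEquiv.piEquivPiSubtypeProd (fun _ : ι => X) p with he_def
  set π₁ : Measure ({i // p i} → X) := Measure.pi fun _ => ν
  set π₂ : Measure ({i // ¬ p i} → X) := Measure.pi fun _ => ν
  have he : MeasurePreserving e (Measure.pi fun _ : ι => ν) (π₁.prod π₂) :=
    measurePreserving_piEquivPiSubtypeProd (fun _ : ι => ν) p
  have hsymm_apply : ∀ (v : {i // p i} → X) (u : {i // ¬ p i} → X) (i : ι),
      e.symm (v, u) i = if hi : p i then v ⟨i, hi⟩ else u ⟨i, hi⟩ := fun v u i => rfl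
  -- Fubini on the transported a.e. equality
  have h1 : g ∘ e.symm =ᵐ[π₁.prod π₂] h ∘ e.symm := (he.symm e).quasiMeasurePreserving.ae_eq_comp hae
  obtain ⟨v₀, hv₀⟩ := (Measure.ae_ae_of_ae_prod h1).exists
  -- freeze the coordinates of `S ∖ T` at `v₀`
  refine ⟨fun ω => g (e.symm (v₀, (e ω).2)), ?_, ?_, ?_⟩
  · exact hgm.comp (e.symm.measurable.comp (measurable_const.prodMk (measurable_snd.comp e.measurable)))
  · intro ω ω' hωω'
    refine hg fun i hi => ?_
    simp only [hsymm_apply]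
    split_ifs with hpi
    · rfl
    · have hiT : i ∈ T := by
        by_contra hiT; exact hpi ⟨hi, hiT⟩
      exact hωω' i ⟨hi, hiT⟩
  · -- compare through `e`
    have hmeas : MeasurableSet {q : ({i // p i} → X) × ({i // ¬ p i} → X) |
        g (e.symm (v₀, q.2)) = h (e.symm q)} :=
      measurableSet_eq_fun (hgm.comp (e.symm.measurable.comp (measurable_const.prodMk measurable_snd)))
        (hhm.comp e.symm.measurable)
    have h2 : ∀ᵐ q ∂(π₁.prod π₂), g (e.symm (v₀, q.2)) = h (e.symm q) := by
      refine (Measure.ae_prod_iff_ae_ae hmeas).2 (ae_of_all _ fun v => ?_)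
      filter_upwards [hv₀] with u hu
      simp only [Function.comp_apply] at hu
      rw [hu]
      refine hh fun i hi => ?_
      have hpi : ¬ p i := fun h' => h'.2 hi
      simp only [hsymm_apply, hpi, dite_false]
    have h3 : (fun q => g (e.symm (v₀, q.2))) =ᵐ[π₁.prod π₂] g ∘ e.symm :=
      (show (fun q => g (e.symm (v₀, q.2))) =ᵐ[π₁.prod π₂] h ∘ e.symm from h2).trans h1.symm
    have h4 := he.quasiMeasurePreserving.ae_eq_comp h3
    filter_upwards [h4] with ω hω
    simpa only [Function.comp_apply, MeasurableEquiv.symm_apply_apply] using hω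

end Product

/-! ### The Wilson state and the product Haar measure -/

section Wilson

variable {G : Type} [Group G] [TopologicalSpace G] [IsTopologicalGroup G] [CompactSpace G]
  [MeasurableSpace G] [BorelSpace G] [SecondCountableTopology G] {Nρ : ℕ}
  (ρ : G →* Matrix (Fin Nρ) (Fin Nρ) ℂ) {N : ℕ} [NeZero N]

/-- **The torus Wilson state and the product Haar measure have the same null sets**: `μ = π.tilted (−β S_W)` with the
bounded continuous Wilson action (Seiler LNP 159 Ch. 1; tree `wilsonMeasure_eq_tilted_pi`), so `μ ≪ π` and `π ≪ μ`.
[folklore] -/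
theorem wilsonMeasure_absolutelyContinuous_pi (hρ : Continuous ρ) (β : ℝ) :
    wilsonMeasure (d := 4) (L := N) ρ β ≪ Measure.pi (fun _ : Edge 4 N => haarProbability G) ∧
      Measure.pi (fun _ : Edge 4 N => haarProbability G) ≪ wilsonMeasure (d := 4) (L := N) ρ β := by
  rw [wilsonMeasure_eq_tilted_pi (d := 4) (L := N) ρ hρ β]
  refine ⟨tilted_absolutelyContinuous _ _, absolutelyContinuous_tilted ?_⟩
  obtain ⟨B, hB⟩ := exists_abs_wilsonAction_le (d := 4) (L := N) ρ hρ
  refine Integrable.of_bound (((measurable_wilsonAction ρ hρ).const_mul _).exp).aestronglyMeasurable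
    (Real.exp (|β| * B)) (ae_of_all _ fun U => ?_)
  rw [Real.norm_eq_abs, Real.abs_exp, Real.exp_le_exp]
  have h : |β * wilsonAction ρ U| ≤ |β| * B := by
    rw [abs_mul]; exact mul_le_mul_of_nonneg_left (hB U) (abs_nonneg _)
  have := (abs_le.1 h).1
  linarith

/-- **`𝓕_S ∩ 𝓕_T = 𝓕_{S ∩ T}` modulo null sets of the Wilson state**: a function `μ`-a.e. equal to an
`𝓕_S`-measurable function and to an `𝓕_T`-measurable function is `μ`-a.e. equal to an `𝓕_{S∩T}`-measurable one
(via the equivalent product Haar measure and `exists_dependsOn_inter_of_ae_eq_pi`). [folklore] -/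
theorem aestronglyMeasurable_linkSigma_inter (hρ : Continuous ρ) (β : ℝ) {S T : Set (Edge 4 N)}
    {f : GaugeConfig 4 N G → ℝ}
    (hS : AEStronglyMeasurable[linkSigma S] f (wilsonMeasure (d := 4) (L := N) ρ β))
    (hT : AEStronglyMeasurable[linkSigma T] f (wilsonMeasure (d := 4) (L := N) ρ β)) :
    AEStronglyMeasurable[linkSigma (S ∩ T)] f (wilsonMeasure (d := 4) (L := N) ρ β) := by
  obtain ⟨hμπ, hπμ⟩ := wilsonMeasure_absolutelyContinuous_pi (N := N) ρ hρ β
  obtain ⟨g, hg, hfg⟩ := hS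
  obtain ⟨h, hh, hfh⟩ := hT
  have hgm : Measurable g := (hg.mono (linkSigma_le S)).measurable
  have hhm : Measurable h := (hh.mono (linkSigma_le T)).measurable
  obtain ⟨k, hk, hkdep, hkg⟩ := exists_dependsOn_inter_of_ae_eq_pi (haarProbability G) hgm hhm
    (dependsOn_of_stronglyMeasurable_linkSigma hg) (dependsOn_of_stronglyMeasurable_linkSigma hh)
    (hπμ.ae_eq (hfg.symm.trans hfh))
  exact ⟨k, (measurable_linkSigma_of_dependsOn hk hkdep).stronglyMeasurable, hfg.trans (hμπ.ae_eq hkg.symm)⟩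

/-- **The kernel of the block heat-bath generator is the constants** (Martinelli 1999 §3): a function which is
`μ`-a.e. equal to an `𝓕_{B_zᶜ}`-measurable function for EVERY block `z` of the torus (`m ≥ 1` cells per axis) is
`μ`-a.e. constant — iterating `aestronglyMeasurable_linkSigma_inter` over all blocks leaves the links read by no block,
and there are none (`exists_inBlock`). [cite: Martinelli1999, §3] -/
theorem ae_eq_const_of_forall_aestronglyMeasurable_extSigma (hρ : Continuous ρ) (β : ℝ) {m : ℕ} [NeZero m]
    {f : GaugeConfig 4 N G → ℝ} (hf0 : AEStronglyMeasurable f (wilsonMeasure (d := 4) (L := N) ρ β))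
    (hf : ∀ z : Fin 4 → Fin m, AEStronglyMeasurable[extSigma G N m z] f (wilsonMeasure (d := 4) (L := N) ρ β)) :
    ∃ c : ℝ, f =ᵐ[wilsonMeasure (d := 4) (L := N) ρ β] fun _ => c := by
  classical
  set μ := wilsonMeasure (d := 4) (L := N) ρ β with hμ
  -- induction over finite sets of blocks
  have key : ∀ 𝒵 : Finset (Fin 4 → Fin m),
      AEStronglyMeasurable[linkSigma {e : Edge 4 N | ∀ z ∈ 𝒵, ¬ InBlock N m z e.1}] f μ := by
    intro 𝒵
    induction 𝒵 using Finset.induction_on with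
    | empty =>
      have : {e : Edge 4 N | ∀ z ∈ (∅ : Finset (Fin 4 → Fin m)), ¬ InBlock N m z e.1} = Set.univ := by
        ext e; simp
      rw [this, linkSigma_univ]; exact hf0
    | insert z 𝒵 hz ih =>
      have : {e : Edge 4 N | ∀ z' ∈ insert z 𝒵, ¬ InBlock N m z' e.1} =
          {e | ¬ InBlock N m z e.1} ∩ {e | ∀ z' ∈ 𝒵, ¬ InBlock N m z' e.1} := by
        ext e; simp
      rw [this]
      exact aestronglyMeasurable_linkSigma_inter ρ hρ β (hf z) ih
  have hempty : {e : Edge 4 N | ∀ z ∈ (Finset.univ : Finset (Fin 4 → Fin m)), ¬ InBlock N m z e.1} = ∅ := by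
    ext e
    simp only [Finset.mem_univ, forall_const, Set.mem_setOf_eq, Set.mem_empty_iff_false, iff_false, not_forall,
      not_not]
    exact exists_inBlock e.1
  have h := key Finset.univ
  rw [hempty] at h
  obtain ⟨k, hk, hfk⟩ := h
  have hkdep := dependsOn_of_stronglyMeasurable_linkSigma hk
  refine ⟨k fun _ => 1, hfk.trans (ae_of_all _ fun U => ?_)⟩
  exact hkdep fun i hi => hi.elim

end Wilson

end Literature.MathematicalPhysics.QuantumLattice.WilsonBlockHeatBath

end
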